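import Literature.Probability.Percolation.LonelyClusterExchange
import HarnessLib

/-!
# `NoHeavyLowerTail` (stmt-CriticalPhenomena-4575) — the GIANT DIAMOND: a two-relay exchange inequality for
# the random giant

Support file (lead `prim-nh-lead-4575`, gen 2; `--supports stmt-CriticalPhenomena-4575`).  No definitions, no sorries.

Setting: bond percolation `μ = prodBernoulli w` with arbitrary edge probabilities on a finite vertex type `V`, a
finite relay set `A`, a level `j`, an observer `o`; for a vertex `v` write `π(v) = {z ∈ A : v ↔ z}`
(`A.filter (fun z => ω ∈ openConn v z)`), "`v` small" for `|π(v)| ≤ j` and "`v` big" for `j < |π(v)|`.  At the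
half level `j = ⌊|A|/2⌋` of the crux ladder "big" means "in the (unique) giant block"; the inequality below is the
only exchange inequality for the RANDOM giant proved so far in the `GCIL`/`GTP` analysis of the `|A| = 5` rung
(lead memos `LEAD-GEN2-v2/v3.md` on the item), where it is the term `p₂m₁ − p₁m₂ ≥ 0` of the champion-transfer
decomposition:

* `giantDiamond` — **for relays `x ≠ y` and any vertex `o`:**
  `μ(o ↔ x, x small, y big) · μ(x big, y small) ≤ μ(o ↔ x, x big, y small) · μ(x small, y big)`,
  i.e. `P(o ↔ x | x small, y big) ≤ P(o ↔ x | x big, y small)` ("`o` reaches `x` more easily when `x` is in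
  the giant and `y` is outside than the other way round").  Proof: on all four events `x ↮ y` (their relay
  blocks have different sizes), so this is van den Berg–Häggström–Kahn's two-cluster exchange (tree
  `twoClusterExchange`, [VandenbergHaggstromKahn2005, Thm. 1.5]) for the pair `(s,t) = (x,y)` with
  `A₁ = {x ↔ o}` (type `(+)`), `B₁ = {x small} ∩ {y big}` (type `(−)`), `A₂ = {x big} ∩ {y small}` (type
  `(+)`), `B₂ = ⊤` — the cardinality events are typed by `LonelyClusterExchange.typePlus_card_le` /
  `typeMinus_card_le` and their complements.
* `giantDiamond_cond` — the conditional-probability (ratio-free, cross-multiplied) form with the two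
  conditioning events made explicit, for citation by the `|A| = 5` certificates.

Numerics (lead gen 2, kit j047003–j047007): 0 violations in 2.7·10⁷ exact evaluations — as it must be.  The
companion "own outsider-ness" transfer `P(o ↔ c | c out) ≤ P(o ↔ c | y out)` is TRUE only for the Φ-champion
`c` against the second-worst relay `y` (= the first prefix inequality of the guarded top packing `GTP`) and is
FALSE for general pairs (exact witnesses in the memos); `giantDiamond` is the part of it that holds for every pair.
-/

noncomputable section

namespace Summit.CriticalPhenomena.PercolationContinuityZ3.Theorems

open MeasureTheory Set Literature.Probability.LatticeModels Literature.Probability.Percolation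
open Literature.Probability.Percolation.LonelyClusterExchange
open scoped Classical

variable {V : Type*}

namespace GiantDiamond

/-- The complement of a type-`(−)` event (closed under shrinking `C_s` and enlarging `C_t`) is of type `(+)`
(closed under enlarging `C_s` and shrinking `C_t`). [folklore] -/
theorem typePlus_compl (s t : V) {B : Set (BondConfig V)}
    (hB : ∀ ⦃ω ω' : BondConfig V⦄, openEdgeCluster ω' s ⊆ openEdgeCluster ω s →
      openEdgeCluster ω t ⊆ openEdgeCluster ω' t → ω ∈ B → ω' ∈ B)
    ⦃ω ω' : BondConfig V⦄ (hs : openEdgeCluster ω s ⊆ openEdgeCluster ω' s)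
    (ht : openEdgeCluster ω' t ⊆ openEdgeCluster ω t) (h : ω ∈ Bᶜ) : ω' ∈ Bᶜ :=
  fun h' => h (hB hs ht h')

/-- The complement of a type-`(+)` event is of type `(−)`. [folklore] -/
theorem typeMinus_compl (s t : V) {A₀ : Set (BondConfig V)}
    (hA : ∀ ⦃ω ω' : BondConfig V⦄, openEdgeCluster ω s ⊆ openEdgeCluster ω' s →
      openEdgeCluster ω' t ⊆ openEdgeCluster ω t → ω ∈ A₀ → ω' ∈ A₀)
    ⦃ω ω' : BondConfig V⦄ (hs : openEdgeCluster ω' s ⊆ openEdgeCluster ω s)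
    (ht : openEdgeCluster ω t ⊆ openEdgeCluster ω' t) (h : ω ∈ A₀ᶜ) : ω' ∈ A₀ᶜ :=
  fun h' => h (hA hs ht h')

/-- If `x ↔ y` then `π(x) = π(y)`. [folklore] -/
theorem filter_eq_of_openConn (A : Finset V) {ω : BondConfig V} {x y : V}
    (h : ω ∈ (openConn x y : Set (BondConfig V))) :
    (A.filter fun z => ω ∈ openConn x z) = (A.filter fun z => ω ∈ openConn y z) := by
  have h' : (openGraph ω).Reachable x y := h
  exact Finset.filter_congr fun z _ =>
    ⟨fun hz => (h'.symm.trans hz : (openGraph ω).Reachable y z),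
      fun hz => (h'.trans hz : (openGraph ω).Reachable x z)⟩

/-- On `{x small} ∩ {y big}` (or the other way round) the relays `x, y` are not joined. [folklore] -/
theorem not_openConn_of_card (A : Finset V) (j : ℕ) {ω : BondConfig V} {x y : V}
    (hx : (A.filter fun z => ω ∈ openConn x z).card ≤ j)
    (hy : j < (A.filter fun z => ω ∈ openConn y z).card) :
    ω ∈ (openConn x y : Set (BondConfig V))ᶜ := by
  intro h
  rw [filter_eq_of_openConn A h] at hx
  exact absurd (lt_of_lt_of_le hy hx) (lt_irrefl _)

end GiantDiamond

open GiantDiamond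

/-- **The giant diamond.**  For `μ = prodBernoulli w` on a finite vertex type, a finite relay set `A`, a level
`j`, relays/vertices `x ≠ y` and any vertex `o` (with `π(v) = {z ∈ A : v ↔ z}`):
`μ(o ↔ x, |π(x)| ≤ j, j < |π(y)|) · μ(j < |π(x)|, |π(y)| ≤ j) ≤ μ(o ↔ x, j < |π(x)|, |π(y)| ≤ j) · μ(|π(x)| ≤ j, j < |π(y)|)`.
One application of BHK's two-cluster exchange for the pair `(x, y)` on `{x ↮ y}` (automatic on all four events).
[cite: VandenbergHaggstromKahn2005, Thm. 1.5 (p. 7) — corollary] -/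
theorem giantDiamond [Fintype V] (w : Sym2 V → unitInterval) (A : Finset V) (j : ℕ) {x y : V} (hxy : x ≠ y)
    (o : V) :
    (prodBernoulli w).real ((openConn x o : Set (BondConfig V)) ∩
        ({ω : BondConfig V | (A.filter fun z => ω ∈ openConn x z).card ≤ j} ∩
          {ω : BondConfig V | j < (A.filter fun z => ω ∈ openConn y z).card})) *
      (prodBernoulli w).real ({ω : BondConfig V | j < (A.filter fun z => ω ∈ openConn x z).card} ∩
          {ω : BondConfig V | (A.filter fun z => ω ∈ openConn y z).card ≤ j}) ≤
    (prodBernoulli w).real ((openConn x o : Set (BondConfig V)) ∩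
        ({ω : BondConfig V | j < (A.filter fun z => ω ∈ openConn x z).card} ∩
          {ω : BondConfig V | (A.filter fun z => ω ∈ openConn y z).card ≤ j})) *
      (prodBernoulli w).real ({ω : BondConfig V | (A.filter fun z => ω ∈ openConn x z).card ≤ j} ∩
          {ω : BondConfig V | j < (A.filter fun z => ω ∈ openConn y z).card}) := by
  -- the four typed events
  set Sx : Set (BondConfig V) := {ω | (A.filter fun z => ω ∈ openConn x z).card ≤ j} with hSx
  set Sy : Set (BondConfig V) := {ω | (A.filter fun z => ω ∈ openConn y z).card ≤ j} with hSy
  have eBx : {ω : BondConfig V | j < (A.filter fun z => ω ∈ openConn x z).card} = Sxᶜ := by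
    ext ω; simp only [hSx, mem_setOf_eq, mem_compl_iff, not_le]
  have eBy : {ω : BondConfig V | j < (A.filter fun z => ω ∈ openConn y z).card} = Syᶜ := by
    ext ω; simp only [hSy, mem_setOf_eq, mem_compl_iff, not_le]
  rw [eBx, eBy]
  -- types for the pair (s,t) = (x,y): Sx is (−), Sy is (+), complements flip
  have hSx_minus := typeMinus_card_le A j x y
  have hSy_plus := typePlus_card_le A j x y
  have key := twoClusterExchange w hxy
    (A₁ := (openConn x o : Set (BondConfig V))) (A₂ := Sxᶜ ∩ Sy) (B₁ := Sx ∩ Syᶜ)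
    (B₂ := (univ : Set (BondConfig V)))
    (typePlus_openConn x y o)
    (fun ω ω' h1 h2 hω => ⟨typePlus_compl x y hSx_minus h1 h2 hω.1, hSy_plus h1 h2 hω.2⟩)
    (fun ω ω' h1 h2 hω => ⟨hSx_minus h1 h2 hω.1, typeMinus_compl x y hSy_plus h1 h2 hω.2⟩)
    (fun _ _ _ _ _ => mem_univ _)
  -- remove the (automatic) separation event `{x ↮ y}`
  have dB1 : ∀ ω ∈ Sx ∩ Syᶜ, ω ∈ (openConn x y : Set (BondConfig V))ᶜ := by
    rintro ω ⟨h1, h2⟩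
    have h2' : j < (A.filter fun z => ω ∈ openConn y z).card := by
      simpa only [hSy, mem_compl_iff, mem_setOf_eq, not_le] using h2
    exact not_openConn_of_card A j h1 h2'
  have dA2 : ∀ ω ∈ Sxᶜ ∩ Sy, ω ∈ (openConn x y : Set (BondConfig V))ᶜ := by
    rintro ω ⟨h1, h2⟩
    have h1' : j < (A.filter fun z => ω ∈ openConn x z).card := by
      simpa only [hSx, mem_compl_iff, mem_setOf_eq, not_le] using h1
    intro h
    exact not_openConn_of_card A j h2 h1' (show ω ∈ (openConn y x : Set (BondConfig V)) from
      (id h : (openGraph ω).Reachable x y).symm)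
  have e1 : (openConn x y : Set (BondConfig V))ᶜ ∩ ((openConn x o : Set (BondConfig V)) ∩ (Sx ∩ Syᶜ)) =
      (openConn x o : Set (BondConfig V)) ∩ (Sx ∩ Syᶜ) := by
    ext ω; constructor
    · rintro ⟨_, h⟩; exact h
    · rintro h; exact ⟨dB1 ω h.2, h⟩
  have e2 : (openConn x y : Set (BondConfig V))ᶜ ∩ ((Sxᶜ ∩ Sy) ∩ (univ : Set (BondConfig V))) = Sxᶜ ∩ Sy := by
    ext ω; constructor
    · rintro ⟨_, h, _⟩; exact h
    · rintro h; exact ⟨dA2 ω h, h, mem_univ _⟩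
  have e3 : (openConn x y : Set (BondConfig V))ᶜ ∩ ((openConn x o : Set (BondConfig V)) ∩ (Sxᶜ ∩ Sy)) =
      (openConn x o : Set (BondConfig V)) ∩ (Sxᶜ ∩ Sy) := by
    ext ω; constructor
    · rintro ⟨_, h⟩; exact h
    · rintro h; exact ⟨dA2 ω h.2, h⟩
  have e4 : (openConn x y : Set (BondConfig V))ᶜ ∩ ((Sx ∩ Syᶜ) ∩ (univ : Set (BondConfig V))) = Sx ∩ Syᶜ := by
    ext ω; constructor
    · rintro ⟨_, h, _⟩; exact h
    · rintro h; exact ⟨dB1 ω h, h, mem_univ _⟩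
  rw [e1, e2, e3, e4] at key
  exact key

/-- **Giant diamond, conditional form.**  With `F = {x small} ∩ {y big}` and `G = {x big} ∩ {y small}`:
`μ(o ↔ x, F) · μ(G) ≤ μ(o ↔ x, G) · μ(F)`, i.e. `P(o ↔ x | F) ≤ P(o ↔ x | G)` whenever both are defined —
the events written with `openConn o x`. [cite: VandenbergHaggstromKahn2005, Thm. 1.5 (p. 7) — corollary] -/
theorem giantDiamond_cond [Fintype V] (w : Sym2 V → unitInterval) (A : Finset V) (j : ℕ) {x y : V}
    (hxy : x ≠ y) (o : V) :
    (prodBernoulli w).real ((openConn o x : Set (BondConfig V)) ∩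
        {ω : BondConfig V | (A.filter fun z => ω ∈ openConn x z).card ≤ j ∧
          j < (A.filter fun z => ω ∈ openConn y z).card}) *
      (prodBernoulli w).real {ω : BondConfig V | j < (A.filter fun z => ω ∈ openConn x z).card ∧
          (A.filter fun z => ω ∈ openConn y z).card ≤ j} ≤
    (prodBernoulli w).real ((openConn o x : Set (BondConfig V)) ∩
        {ω : BondConfig V | j < (A.filter fun z => ω ∈ openConn x z).card ∧
          (A.filter fun z => ω ∈ openConn y z).card ≤ j}) *
      (prodBernoulli w).real {ω : BondConfig V | (A.filter fun z => ω ∈ openConn x z).card ≤ j ∧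
          j < (A.filter fun z => ω ∈ openConn y z).card} := by
  have hox : (openConn o x : Set (BondConfig V)) = openConn x o := by
    ext ω
    exact ⟨fun h => (id h : (openGraph ω).Reachable o x).symm, fun h => (id h : (openGraph ω).Reachable x o).symm⟩
  have e1 : {ω : BondConfig V | (A.filter fun z => ω ∈ openConn x z).card ≤ j ∧
      j < (A.filter fun z => ω ∈ openConn y z).card} =
      ({ω : BondConfig V | (A.filter fun z => ω ∈ openConn x z).card ≤ j} ∩
        {ω : BondConfig V | j < (A.filter fun z => ω ∈ openConn y z).card}) := by
    ext ω; simp only [mem_setOf_eq, mem_inter_iff]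
  have e2 : {ω : BondConfig V | j < (A.filter fun z => ω ∈ openConn x z).card ∧
      (A.filter fun z => ω ∈ openConn y z).card ≤ j} =
      ({ω : BondConfig V | j < (A.filter fun z => ω ∈ openConn x z).card} ∩
        {ω : BondConfig V | (A.filter fun z => ω ∈ openConn y z).card ≤ j}) := by
    ext ω; simp only [mem_setOf_eq, mem_inter_iff]
  rw [hox, e1, e2]
  exact giantDiamond w A j hxy o

end Summit.CriticalPhenomena.PercolationContinuityZ3.Theorems

end
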